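import Summits.BirchSwinnertonDyer.Rank1Residual.X11b.CastellaErratumGrossZagier
import Summits.BirchSwinnertonDyer.Rank1Residual.X11b.BDPRouteManin
import HarnessLib

/-!
# X11b, route R1 — the end form with the Manin-constant package discharged (cell `b2b-bsdres`; written by sub-cell `multr1-p2` for `multr1-p1`)

HONEST FRAMING (cell `b2b-bsdres`, run/shared/lean/b2b/bsd-rank1-residual/, verbatim in every
file): the goal of the cell is to DELETE the COMBINATION-SHAPED residual classes of the
Birch–Swinnerton-Dyer formula for ALL analytic-rank `≤ 1` elliptic curves over `ℚ` — "full BSD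
formula for every rank `≤ 1` curve in class `C`" assembled STRICTLY from published theorems — so
that the rank-`≤ 1` remainder becomes exactly the CONSTRUCTION-SHAPED classes, which are TYPED
(missing-input `Prop`s), NOT attempted. This is not "finishing BSD". Research routes on class X11b;
no claim beyond the stated class and loci; X11b's label does not change.

THEOREMS ONLY (no definition, no named fact). Route R1 (`multr1-p1`, Castella 2018 Thm. A along the
erratum) ends in `routeGoal_of_display` (`X11b/CastellaErratumGrossZagier.lean`): `RouteGoal`
("`BSD(E,p)` for every rank-one pair on `ChainLocus`") from EIGHT published named facts, the
package `hMan` (a parametrisation datum at level `N_E` with Manin constant prime to `p`) and the ONE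
open input (A); `X11b/CastellaErratumOptimal.lean` removed the package for OPTIMAL curves (Mazur
1978 Cor. 4.1). Here the package is removed for EVERY curve: `hMan` is the theorem
`exists_modularParametrizationData_not_dvd` of `X11b/BDPRouteManin.lean` (modularity ⇒ optimal
curve `E₀ ~ E` with `Λ_{E₀} = c₀Λ_f`; Mazur 1978 Cor. 4.1 ⇒ `p ∤ c₀`; a cyclic isogeny `E → E₀` has
degree prime to `p` since `E[p]` is irreducible, and its multiplier and dual multiplier on the
Néron lattices are integers by the Néron mapping property, giving an integral `k`, `p ∤ k`, with
`kΛ_{E₀} ⊆ Λ_E` and the datum `(f, Λ_E, k c₀)`). So route R1 reads: TEN published named facts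
(the eight, Mazur 1978 Cor. 4.1, the Néron mapping property `integral_neronScaling_of_isGloballyMinimal`)
+ the ONE open input (A) ⇒ `RouteGoal`. CONDITIONAL on (A); deletes nothing; X11b stays
CONSTRUCTION-SHAPED.

References: [Castella2018] §5; [Castella2018Erratum] Thm. 1.1, Thm. A′; [Mazur1978] Cor. 4.1;
[SilvermanATAEC1994] IV.5.1, IV.6.1, Cor. IV.9.1; [JetchevSkinnerWan2017] Remark 43.
-/

noncomputable section

open scoped Classical

open WeierstrassCurve NumberField Literature.NumberTheory.EllipticCurves
  Literature.NumberTheory.EllipticCurves.ModularForms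
  Literature.NumberTheory.EllipticCurves.Rank1Residual

namespace Summit.BirchSwinnertonDyer.Rank1Residual.X11b

/-- **The Manin package of route R1, discharged**: for every globally minimal elliptic `W/ℚ` and
prime `p` with `ErratumHypotheses W p` (`p ≥ 5`, multiplicative at `p` — so `p² ∤ N_E`,
`not_sq_dvd_conductorNorm_of_mult` —, `E[p]` irreducible, A′-locus) there is a parametrisation datum
at level `N_E` with Manin constant prime to `p` (`exists_modularParametrizationData_not_dvd`:
modularity `hmod`, Mazur 1978 Cor. 4.1 `hMaz`, Néron mapping property `hNS`). The rank hypothesis of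
the package is not used. [cite: Mazur1978, Cor. 4.1]
[cite: SilvermanATAEC1994, IV.5.1 with IV.6.1 and Cor. IV.9.1]
[cite: JetchevSkinnerWan2017, Remark 43 and §7.4.1 (p. 30)] -/
theorem maninPackage_of_neronScaling (hmod : exists_isNewformOf)
    (hMaz : mazur_not_dvd_maninConstant_of_odd) (hNS : integral_neronScaling_of_isGloballyMinimal) :
    ∀ (W : WeierstrassCurve ℚ) [W.IsElliptic] [W.IsGloballyMinimal]
      [NeZero (W.conductorNorm ℤ)] (p : ℕ) [Fact p.Prime],
      ErratumHypotheses W p → W.analyticRank = 1 →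
      ∃ Dt : ModularParametrizationData W (W.conductorNorm ℤ), ¬ (p : ℤ) ∣ Dt.c := by
  intro W _ _ _ p _ hE _
  have hp : p.Prime := Fact.out
  have hp2 : p ≠ 2 := by have := hE.1; omega
  exact exists_modularParametrizationData_not_dvd hmod hMaz hNS W rfl hp hp2
    (not_sq_dvd_conductorNorm_of_mult W p hE.2.1) hE.2.2.1

/-- **Route R1's end form with NO package: `RouteGoal` from TEN published named facts and the ONE
open input (A).** Inputs: `hGZ` (Gross–Zagier I.7.3), `hGZK` (Gross–Zagier–Kolyvagin over `ℚ`),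
`hSk` (Skinner 2016 Thm. C), `hmod` (modularity), `hEx`, `hRat`, `hCST` (Cai–Shu–Tian 2014),
`hFH` (Friedberg–Hoffstein), `hMaz` (Mazur 1978 Cor. 4.1), `hNS` (Néron mapping property for
globally minimal models) — all PUBLISHED named facts of the tree —, and `hA` — OPEN: the display
(5.3) at data with `p ∤ c` (⇐ erratum Thm. 1.1 ⇐ Fouquet–Wan 2021 Thm. 4.41, unrefereed).
Conclusion: `BSD(E,p)` for every globally minimal elliptic `W/ℚ` on `ChainLocus` at `p` with
`ord_{s=1} L(E,s) = 1` — `routeGoal_of_display` with its package `hMan` supplied by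
`maninPackage_of_neronScaling`. CONDITIONAL on `hA`; deletes nothing; X11b stays
CONSTRUCTION-SHAPED. [cite: Castella2018, §5 (arXiv:1704.06608 p. 12)]
[cite: Castella2018Erratum, Thm. 1.1 and Thm. A′ (p. 1)] [cite: Mazur1978, Cor. 4.1]
[cite: SilvermanATAEC1994, IV.5.1 with IV.6.1 and Cor. IV.9.1] -/
theorem routeGoal_of_display_of_neronScaling
    (hGZ : GrossZagier1986_thm_I_7_3) (hGZK : rank_eq_analyticRank_of_analyticRank_le_one)
    (hSk : Skinner2016.thmC_padicValRat_bsd_rank_zero) (hmod : exists_isNewformOf)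
    (hEx : CaiShuTian2014.exists_isHeegnerPoint_of_heegnerCondition)
    (hRat : CaiShuTian2014.exists_map_eq_heegnerPointComplex_of_heegnerCondition)
    (hCST : CaiShuTian2014.thm11_trivialChar)
    (hFH : friedbergHoffstein_exists_twist_ne_zero_ramifiedAt)
    (hMaz : mazur_not_dvd_maninConstant_of_odd) (hNS : integral_neronScaling_of_isGloballyMinimal)
    (hA : ∀ (W : WeierstrassCurve ℚ) [W.IsElliptic] [W.IsGloballyMinimal] [NeZero (W.conductorNorm ℤ)]
        (p : ℕ) [Fact p.Prime] (q : ℕ) [Fact q.Prime] (K : Type) [Field K] [NumberField K]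
        (Dt : ModularParametrizationData W (W.conductorNorm ℤ))
        (H : HeegnerDatum (W.conductorNorm ℤ) (NumberField.discr K)) (ι : K →+* ℂ)
        (P : (W.baseChange K).toAffine.Point),
        ErratumHypotheses W p → W.analyticRank = 1 → q ≠ p → Mult W q →
        ¬ W.HasSplitMultiplicativeReductionAtPrime q → ¬ p ∣ padicValInt q W.minimalDiscriminantInt →
        IsErratumField W K q →
        WeierstrassCurve.Affine.Point.map ι.toRatAlgHom P = heegnerPointComplex Dt H →
        ¬ (p : ℤ) ∣ Dt.c → ¬ IsOfFinAddOrder P → Display53At W p K P) :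
    RouteGoal :=
  routeGoal_of_display hGZ hGZK hSk hmod hEx hRat hCST hFH (maninPackage_of_neronScaling hmod hMaz hNS)
    hA

end Summit.BirchSwinnertonDyer.Rank1Residual.X11b

end
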